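import Literature.NumberTheory.Sieve.BombieriFriedlanderIwaniecBoxes
import Literature.NumberTheory.Sieve.BombieriFriedlanderIwaniecBilinear
import Literature.NumberTheory.Sieve.BombieriFriedlanderIwaniecSiegelWalfisz
import Literature.NumberTheory.Sieve.CoprimeSquarefreeSums
import HarnessLib

/-!
# Bombieri–Friedlander–Iwaniec 1986: partition of a sieved Heath-Brown piece into box-tuples

Trunk `AntSieve`, companion to `Literature.NumberTheory.Sieve.BombieriFriedlanderIwaniecBoxes`.
Everything here is PROVED.  For the sieved dyadic discrepancy of the `j`-th Heath-Brown piece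
(`Literature.BFI.sievedDisc (hbPiece U j) q a z x`, BFI (15.1) after Lemma 5), the fine boxes of the companion
file give (BFI §15, p. 245–246; the `log n₁` of (2.1) is replaced by a constant on each box, as the
display of `Δ(M₁,…,M_j | N₁,…,N_j; q, a)` on p. 245 presupposes):

`sievedDisc (hbPiece U j) q a z x = ∑_{κ interior} c_κ · sievedDisc (PMain κ) q a z x + (boundary) + (log-error)`

where `κ` runs over box-tuples `Fin (2j) → {0,…,K−1}`, `PMain κ` is the Dirichlet product of the boxed,
sieved factors (with `log` replaced by `1`), `c_κ = log (box end) ∈ [0, log 2x]`, "interior" means the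
product box lies inside `(x, 2x]`, and

* `∑_κ |PErr κ (n)| ≤ Δ τ(n)^{2j}`, `∑_κ |PMain κ (n)| ≤ τ(n)^{2j}` pointwise
  (`sum_abs_prodErr_le`, `sum_abs_prodMain_le`);
* for NON-interior `κ`, `PMain κ` vanishes on `(x,2x]` off the two slivers
  `(x, x(1+Δ)^{2j}] ∪ (2x(1+Δ)^{−2j}, 2x]` (`mem_slivers_of_not_interior`);
* for INTERIOR `κ` and any splitting of the factors into two nonempty groups `α`, `β`, the supports
  multiply into `(x, 2x]`, lie in dyadic ranges `m ∼ M`, `n ∼ N` with `MN = ∏ (box ends)`, and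
  `sievedDisc (α ⋆ β) q a z x = bilinDisc a M N α β q` (`sievedDisc_eq_bilinDisc`), the bracket of
  BFI (3.1) to which Theorems 0, 1, 2, 5* apply.

## References

* E. Bombieri, J. B. Friedlander, H. Iwaniec, Acta Math. 156 (1986), §15 pp. 244–247.
  [BombieriFriedlanderIwaniecActa1986]
-/

open Finset Real
open scoped ArithmeticFunction.zeta ArithmeticFunction.sigma ArithmeticFunction.Moebius

namespace Literature.NumberTheory.Sieve

namespace BFI

/-! ### `sievedDisc` only sees rough-restricted values -/

/-- `sievedDisc F` depends only on the values of `F` at `z`-rough `n ∈ (x, 2x]`. [folklore] -/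
theorem sievedDisc_congr_rough {F G : ℕ → ℝ} {x z : ℝ}
    (h : ∀ n ∈ Ioc ⌊x⌋₊ ⌊2 * x⌋₊, IsRough z n → F n = G n) (q : ℕ) (a : ℤ) :
    sievedDisc F q a z x = sievedDisc G q a z x := by
  unfold sievedDisc
  congr 1
  · refine Finset.sum_congr rfl fun n hn => ?_
    split_ifs with h1
    · exact h n hn h1.1
    · rfl
  · congr 1
    refine Finset.sum_congr rfl fun n hn => ?_
    split_ifs with h1
    · exact h n hn h1.1
    · rfl

/-- `sievedDisc F = sievedDisc (roughRestrict z F)`. [folklore] -/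
theorem sievedDisc_roughRestrict (F : ArithmeticFunction ℝ) (q : ℕ) (a : ℤ) (z x : ℝ) :
    sievedDisc (roughRestrict z F) q a z x = sievedDisc F q a z x :=
  sievedDisc_congr_rough (fun n _ hn => by rw [roughRestrict_apply, if_pos hn]) q a

/-- Additivity of `sievedDisc` over a `Finset` (no weights). [folklore] -/
theorem sievedDisc_finset_sum {ι : Type*} (s : Finset ι) (F : ι → ℕ → ℝ) (q : ℕ) (a : ℤ) (z x : ℝ) :
    sievedDisc (fun n => ∑ i ∈ s, F i n) q a z x = ∑ i ∈ s, sievedDisc (F i) q a z x := by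
  have h := sievedDisc_sum s (fun _ => (1 : ℝ)) F q a z x
  simp only [one_mul] at h
  exact h

/-! ### The shifted logarithm

Scalars act on `ArithmeticFunction ℝ` POINTWISE through Mathlib's `Module ℝ (ArithmeticFunction ℝ)`
(`ArithmeticFunction.smul_map : (c • F) n = c • F n`); with the `Algebra ℝ (ArithmeticFunction ℝ)` structure
`smul_mul_assoc : c • F * G = c • (F * G)` relates it to the Dirichlet product. -/

/-- The shifted logarithm `n ↦ log n − c` (`n ≥ 1`), `0 ↦ 0`. [folklore] -/
noncomputable def logShift (c : ℝ) : ArithmeticFunction ℝ where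
  toFun n := if n = 0 then 0 else Real.log n - c
  map_zero' := by simp

/-- Unfolding `logShift` at `n ≠ 0`. [folklore] -/
theorem logShift_apply_ne {c : ℝ} {n : ℕ} (hn : n ≠ 0) : logShift c n = Real.log n - c := by
  show (if n = 0 then 0 else Real.log n - c) = _; rw [if_neg hn]

/-- `logShift c = log − c • ζ` in Mathlib's vocabulary (pointwise scalar action). [folklore] -/
theorem logShift_eq (c : ℝ) :
    logShift c = ArithmeticFunction.log - c • (ζ : ArithmeticFunction ℝ) := by
  ext n
  rw [sub_eq_add_neg, ArithmeticFunction.add_apply, ArithmeticFunction.neg_apply,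
    ArithmeticFunction.smul_map, smul_eq_mul, ArithmeticFunction.natCoe_apply, ArithmeticFunction.log_apply]
  rcases eq_or_ne n 0 with rfl | hn
  · simp [logShift]
  · rw [logShift_apply_ne hn, ArithmeticFunction.zeta_apply_ne hn, Nat.cast_one, mul_one, sub_eq_add_neg]

/-! ### The setting: boxes of the Heath-Brown factors -/

section Setting

variable (x z Δ : ℝ) (U j K : ℕ)

/-- The constant replacing `log` on the `k`-th box: `c_k = log (max 1 (boxLow k))` (`T = 2x`).
[cite: BombieriFriedlanderIwaniecActa1986, §15 p. 245] -/
noncomputable def boxLogConst (k : ℕ) : ℝ := Real.log (max 1 (boxLow (2 * x) Δ k))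

/-- The boxed, sieved `i`-th factor with box index `k`, `log` replaced by `1` ("main" factors).
[cite: BombieriFriedlanderIwaniecActa1986, §15 p. 245] -/
noncomputable def factorMain (i k : ℕ) : ArithmeticFunction ℝ :=
  boxRestrict (2 * x) Δ k (roughRestrict z
    (if i = 2 * j - 1 then (ζ : ArithmeticFunction ℝ) else hbFactor U j i))

/-- The boxed, sieved `i`-th factor with box index `k`, `log` replaced by `log − c_k` in the last slot
("error" factors). [cite: BombieriFriedlanderIwaniecActa1986, §15 p. 245] -/
noncomputable def factorErr (i k : ℕ) : ArithmeticFunction ℝ :=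
  boxRestrict (2 * x) Δ k (roughRestrict z
    (if i = 2 * j - 1 then logShift (boxLogConst x Δ k) else hbFactor U j i))

/-- The boxed, sieved `i`-th factor (the honest one, with `log` in the last slot). [folklore] -/
noncomputable def factorFull (i k : ℕ) : ArithmeticFunction ℝ :=
  boxRestrict (2 * x) Δ k (roughRestrict z (hbFactor U j i))

/-- The main product of a box-tuple `κ`: `PMain κ = ∏_i factorMain i (κ i)`.
[cite: BombieriFriedlanderIwaniecActa1986, §15 p. 245] -/
noncomputable def prodMain (κ : Fin (2 * j) → ℕ) : ArithmeticFunction ℝ :=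
  ∏ i : Fin (2 * j), factorMain x z Δ U j i (κ i)

/-- The error product of a box-tuple `κ`: `PErr κ = ∏_i factorErr i (κ i)`. [folklore] -/
noncomputable def prodErr (κ : Fin (2 * j) → ℕ) : ArithmeticFunction ℝ :=
  ∏ i : Fin (2 * j), factorErr x z Δ U j i (κ i)

/-- The coefficient `c_κ = c_{κ(2j−1)}` of the main product. [folklore] -/
noncomputable def tupleConst (κ : Fin (2 * j) → ℕ) : ℝ :=
  if h : 0 < 2 * j then boxLogConst x Δ (κ ⟨2 * j - 1, by omega⟩) else 0

/-- The lower end `∏_i boxLow (κ i)` of the product box of `κ`. [folklore] -/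
noncomputable def tupleLow (κ : Fin (2 * j) → ℕ) : ℝ := ∏ i : Fin (2 * j), boxLow (2 * x) Δ (κ i)

/-- The upper end `∏_i boxHigh (κ i)` of the product box of `κ`. [folklore] -/
noncomputable def tupleHigh (κ : Fin (2 * j) → ℕ) : ℝ := ∏ i : Fin (2 * j), boxHigh (2 * x) Δ (κ i)

/-- `κ` is INTERIOR if its product box `(tupleLow κ, tupleHigh κ]` lies inside `(x, 2x]`
(BFI's boxes with `M₁⋯M_j N₁⋯N_j = x`, p. 245). [cite: BombieriFriedlanderIwaniecActa1986, §15 p. 245] -/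
def Interior (κ : Fin (2 * j) → ℕ) : Prop := x ≤ tupleLow x Δ j κ ∧ tupleHigh x Δ j κ ≤ 2 * x

/-- `Interior` is decidable (classically). [folklore] -/
noncomputable instance instDecidableInterior (κ : Fin (2 * j) → ℕ) : Decidable (Interior x Δ j κ) := by
  unfold Interior; infer_instance

/-- The set of box-tuples: `Fin (2j) → {0, …, K−1}`. [folklore] -/
noncomputable def tuples : Finset (Fin (2 * j) → ℕ) := Fintype.piFinset fun _ : Fin (2 * j) => Finset.range K

end Setting

/-! ### Linearity of the restrictions; the last factor -/

/-- `boxRestrict ∘ roughRestrict` is additive. [folklore] -/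
theorem boxRestrict_roughRestrict_add (T Δ z : ℝ) (k : ℕ) (F G : ArithmeticFunction ℝ) :
    boxRestrict T Δ k (roughRestrict z (F + G)) =
      boxRestrict T Δ k (roughRestrict z F) + boxRestrict T Δ k (roughRestrict z G) := by
  ext n
  simp only [boxRestrict_apply, roughRestrict_apply, ArithmeticFunction.add_apply]
  split_ifs <;> simp

section Main

variable {x z Δ : ℝ} {U j K : ℕ}

/-- Off the last slot the three kinds of factors agree. [folklore] -/
theorem factorMain_eq_factorFull {i : ℕ} (hi : i ≠ 2 * j - 1) (k : ℕ) :
    factorMain x z Δ U j i k = factorFull x z Δ U j i k := by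
  unfold factorMain factorFull; rw [if_neg hi]

/-- Off the last slot the three kinds of factors agree. [folklore] -/
theorem factorErr_eq_factorFull {i : ℕ} (hi : i ≠ 2 * j - 1) (k : ℕ) :
    factorErr x z Δ U j i k = factorFull x z Δ U j i k := by
  unfold factorErr factorFull; rw [if_neg hi]

/-- In the last slot: `Full = c_k · Main + Err` (`log = c_k · 1 + (log − c_k)`). [folklore] -/
theorem factorFull_last (hj : 1 ≤ j) (k : ℕ) :
    factorFull x z Δ U j (2 * j - 1) k =
      boxLogConst x Δ k • factorMain x z Δ U j (2 * j - 1) k + factorErr x z Δ U j (2 * j - 1) k := by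
  unfold factorFull factorMain factorErr
  rw [if_pos rfl, if_pos rfl, hbFactor, if_neg (by omega), if_neg (lt_irrefl _)]
  ext n
  simp only [boxRestrict_apply, roughRestrict_apply, ArithmeticFunction.add_apply,
    ArithmeticFunction.smul_map, smul_eq_mul]
  by_cases hin : InBox (2 * x) Δ k n
  · have hn : n ≠ 0 := hin.1.ne'
    rw [if_pos hin, if_pos hin, if_pos hin]
    by_cases hr : IsRough z n
    · rw [if_pos hr, if_pos hr, if_pos hr, ArithmeticFunction.log_apply, logShift_apply_ne hn,
        ArithmeticFunction.natCoe_apply, ArithmeticFunction.zeta_apply_ne hn, Nat.cast_one]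
      ring
    · rw [if_neg hr, if_neg hr, if_neg hr]; ring
  · rw [if_neg hin, if_neg hin, if_neg hin]; ring

/-- **The product over a box-tuple splits**: `∏_i factorFull i (κ i) = c_κ • PMain κ + PErr κ`.
[cite: BombieriFriedlanderIwaniecActa1986, §15 p. 245] -/
theorem prod_factorFull_eq (hj : 1 ≤ j) (κ : Fin (2 * j) → ℕ) :
    ∏ i : Fin (2 * j), factorFull x z Δ U j i (κ i) =
      tupleConst x Δ j κ • prodMain x z Δ U j κ + prodErr x z Δ U j κ := by
  have h2j : 0 < 2 * j := by omega
  set i₀ : Fin (2 * j) := ⟨2 * j - 1, by omega⟩ with hi₀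
  have hmem : i₀ ∈ (Finset.univ : Finset (Fin (2 * j))) := Finset.mem_univ _
  have hne : ∀ i : Fin (2 * j), i ≠ i₀ → (i : ℕ) ≠ 2 * j - 1 := by
    intro i hi h
    apply hi
    ext; exact h
  unfold prodMain prodErr tupleConst
  rw [dif_pos h2j]
  rw [← Finset.mul_prod_erase _ (fun i : Fin (2 * j) => factorFull x z Δ U j (i : ℕ) (κ i)) hmem,
    ← Finset.mul_prod_erase _ (fun i : Fin (2 * j) => factorMain x z Δ U j (i : ℕ) (κ i)) hmem,
    ← Finset.mul_prod_erase _ (fun i : Fin (2 * j) => factorErr x z Δ U j (i : ℕ) (κ i)) hmem]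
  have hM : ∏ i ∈ Finset.univ.erase i₀, factorMain x z Δ U j i (κ i) =
      ∏ i ∈ Finset.univ.erase i₀, factorFull x z Δ U j i (κ i) :=
    Finset.prod_congr rfl fun i hi => factorMain_eq_factorFull (hne i (Finset.ne_of_mem_erase hi)) _
  have hE : ∏ i ∈ Finset.univ.erase i₀, factorErr x z Δ U j i (κ i) =
      ∏ i ∈ Finset.univ.erase i₀, factorFull x z Δ U j i (κ i) :=
    Finset.prod_congr rfl fun i hi => factorErr_eq_factorFull (hne i (Finset.ne_of_mem_erase hi)) _
  rw [hM, hE, show ((i₀ : Fin (2 * j)) : ℕ) = 2 * j - 1 from rfl, factorFull_last hj]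
  rw [add_mul, smul_mul_assoc]

/-- **Decomposition of the sieved Heath-Brown piece into box-tuples** (BFI §15, p. 245–246): for
`j ≥ 1`, `x > 0`, `Δ > 0` and `2x < (1+Δ)^K`,
`sievedDisc (hbPiece U j) q a z x = ∑_{κ} (c_κ · sievedDisc (PMain κ) q a z x + sievedDisc (PErr κ) q a z x)`,
`κ` over all box-tuples `Fin (2j) → {0,…,K−1}`. [cite: BombieriFriedlanderIwaniecActa1986, §15 p. 245–246] -/
theorem sievedDisc_hbPiece_eq (hj : 1 ≤ j) (hx : 0 < x) (hΔ : 0 < Δ) (hK : 2 * x < (1 + Δ) ^ K)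
    (q : ℕ) (a : ℤ) :
    sievedDisc (fun n => hbPiece U j n) q a z x =
      ∑ κ ∈ tuples j K, (tupleConst x Δ j κ * sievedDisc (fun n => prodMain x z Δ U j κ n) q a z x +
        sievedDisc (fun n => prodErr x z Δ U j κ n) q a z x) := by
  have hT : 0 < 2 * x := by linarith
  -- Step A: pass to the rough-restricted factors
  have hA : sievedDisc (fun n => hbPiece U j n) q a z x =
      sievedDisc (fun n => (∏ i : Fin (2 * j), roughRestrict z (hbFactor U j i)) n) q a z x := by
    rw [hbPiece_eq_prod_hbFactor U hj, Finset.prod_range]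
    rw [← sievedDisc_roughRestrict (∏ i : Fin (2 * j), hbFactor U j ↑i),
      ← roughRestrict_prod_roughRestrict, sievedDisc_roughRestrict]
  rw [hA]
  -- Step B: expand each factor over the boxes (valid on `[1, 2x]`)
  have hB : ∀ n ∈ Ioc ⌊x⌋₊ ⌊2 * x⌋₊,
      (∏ i : Fin (2 * j), roughRestrict z (hbFactor U j i)) n =
        ∑ κ ∈ tuples j K, (∏ i : Fin (2 * j), factorFull x z Δ U j i (κ i)) n := by
    intro n hn
    have hn2 : (n : ℝ) ≤ 2 * x := by
      have := (Finset.mem_Ioc.1 hn).2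
      exact le_trans (by exact_mod_cast this) (Nat.floor_le hT.le)
    exact prod_apply_eq_sum_prod_boxRestrict_apply hT hΔ hK _ hn2
  rw [sievedDisc_congr hB]
  -- Step C: the split of each product and linearity of `sievedDisc`
  have hC : ∀ n : ℕ, ∑ κ ∈ tuples j K, (∏ i : Fin (2 * j), factorFull x z Δ U j i (κ i)) n =
      ∑ κ ∈ tuples j K, (tupleConst x Δ j κ * prodMain x z Δ U j κ n + prodErr x z Δ U j κ n) := by
    intro n
    refine Finset.sum_congr rfl fun κ _ => ?_
    rw [prod_factorFull_eq hj κ, ArithmeticFunction.add_apply, ArithmeticFunction.smul_map, smul_eq_mul]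
  simp_rw [hC]
  rw [sievedDisc_finset_sum]
  refine Finset.sum_congr rfl fun κ _ => ?_
  rw [sievedDisc_add, sievedDisc_smul]

/-! ### Pointwise bounds -/

/-- `|hbFactor U j i| ≤ 1` off the last slot (truncated Möbius or `1`). [folklore] -/
theorem abs_hbFactor_le_one {i : ℕ} (hi : i ≠ 2 * j - 1) (hij : i < 2 * j) (n : ℕ) :
    |hbFactor U j i n| ≤ 1 := by
  unfold hbFactor
  split_ifs with h1 h2
  · rw [ArithmeticFunction.intCoe_apply, moebiusTrunc_apply]
    split_ifs
    · exact_mod_cast ArithmeticFunction.abs_moebius_le_one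
    · simp
  · rw [ArithmeticFunction.natCoe_apply, ArithmeticFunction.zeta_apply]
    split_ifs <;> simp
  · omega

/-- `|ζ n| ≤ 1` (the same three-line statement is proved as
`Literature.NumberTheory.Sieve.MatomakiRadziwillThm1.abs_zeta_le_one` in `MatomakiRadziwillTheorem1.lean`, which is not
imported here to keep this file's import closure inside the BFI development). [folklore] -/
theorem abs_zeta_le_one (n : ℕ) : |((ζ : ArithmeticFunction ℝ)) n| ≤ 1 := by
  rw [ArithmeticFunction.natCoe_apply, ArithmeticFunction.zeta_apply]
  split_ifs <;> simp

/-- `|factorMain i k| ≤ 1` pointwise (`i < 2j`). [folklore] -/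
theorem abs_factorMain_le_one {i : ℕ} (hij : i < 2 * j) (k n : ℕ) : |factorMain x z Δ U j i k n| ≤ 1 := by
  unfold factorMain
  refine (abs_boxRestrict_le _ _ _).trans ?_
  rw [roughRestrict_apply]
  split_ifs with h1 h2
  · exact abs_zeta_le_one n
  · exact abs_hbFactor_le_one h2 hij n
  · simp

/-- `0 ≤ c_k`. [folklore] -/
theorem boxLogConst_nonneg (k : ℕ) : 0 ≤ boxLogConst x Δ k :=
  Real.log_nonneg (le_max_left _ _)

/-- `c_k ≤ log (2x)` for `2x ≥ 1`, `Δ ≥ 0`. [folklore] -/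
theorem boxLogConst_le (hx : 1 ≤ 2 * x) (hΔ : 0 ≤ Δ) (k : ℕ) : boxLogConst x Δ k ≤ Real.log (2 * x) := by
  unfold boxLogConst
  refine Real.log_le_log (lt_of_lt_of_le one_pos (le_max_left _ _)) (max_le hx ?_)
  calc boxLow (2 * x) Δ k ≤ boxLow (2 * x) Δ 0 := boxLow_anti (by linarith) hΔ (Nat.zero_le k)
    _ = 2 * x / (1 + Δ) := by unfold boxLow; rw [pow_one]
    _ ≤ 2 * x := div_le_self (by linarith) (by linarith)

/-- `0 ≤ c_κ ≤ log (2x)`. [folklore] -/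
theorem tupleConst_nonneg (κ : Fin (2 * j) → ℕ) : 0 ≤ tupleConst x Δ j κ := by
  unfold tupleConst; split_ifs
  · exact boxLogConst_nonneg _
  · exact le_rfl

/-- `c_κ ≤ log (2x)`. [folklore] -/
theorem tupleConst_le (hx : 1 ≤ 2 * x) (hΔ : 0 ≤ Δ) (κ : Fin (2 * j) → ℕ) :
    tupleConst x Δ j κ ≤ Real.log (2 * x) := by
  unfold tupleConst; split_ifs
  · exact boxLogConst_le hx hΔ _
  · exact Real.log_nonneg hx

/-- On the `k`-th box, `|log n − c_k| ≤ Δ` (`0 < Δ ≤ 1`). [folklore] -/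
theorem abs_log_sub_boxLogConst_le (hx : 0 < x) (hΔ : 0 < Δ) (hΔ1 : Δ ≤ 1) {k n : ℕ}
    (hn : InBox (2 * x) Δ k n) : |Real.log n - boxLogConst x Δ k| ≤ Δ := by
  obtain ⟨hn0, hlow, hhigh⟩ := hn
  have hΔ' : -1 < Δ := by linarith
  rw [boxHigh_eq_mul_boxLow hΔ'] at hhigh
  have hbl : 0 < boxLow (2 * x) Δ k := boxLow_pos (by linarith) hΔ' k
  unfold boxLogConst
  by_cases hb : 1 ≤ boxLow (2 * x) Δ k
  · rw [max_eq_right hb]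
    have hn0' : (0 : ℝ) < n := by exact_mod_cast hn0
    rw [← Real.log_div hn0'.ne' hbl.ne']
    have h1 : 1 < (n : ℝ) / boxLow (2 * x) Δ k := by rw [lt_div_iff₀ hbl]; linarith
    have h2 : (n : ℝ) / boxLow (2 * x) Δ k ≤ 1 + Δ := by rw [div_le_iff₀ hbl]; linarith
    rw [abs_of_nonneg (Real.log_nonneg h1.le)]
    calc Real.log ((n : ℝ) / boxLow (2 * x) Δ k) ≤ Real.log (1 + Δ) := Real.log_le_log (by linarith) h2
      _ ≤ Δ := by
          have := Real.add_one_le_exp Δ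
          rw [Real.log_le_iff_le_exp (by linarith)]; linarith
  · rw [not_le] at hb
    rw [max_eq_left hb.le, Real.log_one, sub_zero]
    have hn2 : (n : ℝ) < 2 := by nlinarith
    have hn1 : n = 1 := by
      have : n < 2 := by exact_mod_cast hn2
      omega
    rw [hn1, Nat.cast_one, Real.log_one, abs_zero]
    exact hΔ.le

/-- `|factorErr i k| ≤ 1` off the last slot, `≤ Δ` in the last slot. [folklore] -/
theorem abs_factorErr_le (hx : 0 < x) (hΔ : 0 < Δ) (hΔ1 : Δ ≤ 1) {i : ℕ} (hij : i < 2 * j) (k n : ℕ) :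
    |factorErr x z Δ U j i k n| ≤ if i = 2 * j - 1 then Δ else 1 := by
  unfold factorErr
  rw [boxRestrict_apply]
  split_ifs with hin hi hi'
  · rw [roughRestrict_apply]
    split_ifs
    · rw [logShift_apply_ne hin.1.ne']
      exact abs_log_sub_boxLogConst_le hx hΔ hΔ1 hin
    · rw [abs_zero]; exact hΔ.le
  · rw [roughRestrict_apply]
    split_ifs
    · exact abs_hbFactor_le_one hi hij n
    · simp
  · rw [abs_zero]; exact hΔ.le
  · simp

/-- Box sums of restrictions of `k`-dependent functions: if at most the box containing `d` matters and
there `|F_k d| ≤ B`, then `∑_{k<K} |boxRestrict k (F_k) d| ≤ B`. [folklore] -/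
theorem sum_abs_boxRestrict_dep_le {T Δ' : ℝ} (hT : 0 < T) (hΔ : 0 ≤ Δ') (K : ℕ)
    (F : ℕ → ArithmeticFunction ℝ) {B : ℝ} (hB : 0 ≤ B) (d : ℕ)
    (hF : ∀ k, InBox T Δ' k d → |F k d| ≤ B) :
    ∑ k ∈ Finset.range K, |boxRestrict T Δ' k (F k) d| ≤ B := by
  by_cases h : ∃ k ∈ Finset.range K, InBox T Δ' k d
  · obtain ⟨k₀, hk₀, hin⟩ := h
    rw [Finset.sum_eq_single k₀]
    · rw [boxRestrict_apply, if_pos hin]; exact hF k₀ hin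
    · intro k _ hk
      rw [boxRestrict_apply, if_neg, abs_zero]
      exact fun hk' => hk (hk'.eq_of_inBox hT hΔ hin)
    · intro h'; exact absurd hk₀ h'
  · push Not at h
    rw [Finset.sum_eq_zero fun k hk => by rw [boxRestrict_apply, if_neg (h k hk), abs_zero]]
    exact hB

/-- `∑_{k<K} |factorMain i k (d)| ≤ 1_{d ≥ 1}`. [folklore] -/
theorem sum_abs_factorMain_le (hx : 0 < x) (hΔ : 0 ≤ Δ) {i : ℕ} (hij : i < 2 * j) (K d : ℕ) :
    ∑ k ∈ Finset.range K, |factorMain x z Δ U j i k d| ≤ ((ζ : ArithmeticFunction ℝ)) d := by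
  rcases Nat.eq_zero_or_pos d with rfl | hd
  · simp
  rw [ArithmeticFunction.natCoe_apply, ArithmeticFunction.zeta_apply_ne hd.ne', Nat.cast_one]
  unfold factorMain
  refine sum_abs_boxRestrict_dep_le (by linarith) hΔ K _ zero_le_one d fun k _ => ?_
  rw [roughRestrict_apply]
  split_ifs with h1 h2
  · exact abs_zeta_le_one d
  · exact abs_hbFactor_le_one h2 hij d
  · simp

/-- `∑_{k<K} |factorErr i k (d)| ≤ (Δ or 1) · 1_{d ≥ 1}`. [folklore] -/
theorem sum_abs_factorErr_le (hx : 0 < x) (hΔ : 0 < Δ) (hΔ1 : Δ ≤ 1) {i : ℕ} (hij : i < 2 * j) (K d : ℕ) :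
    ∑ k ∈ Finset.range K, |factorErr x z Δ U j i k d| ≤
      (if i = 2 * j - 1 then Δ else 1) * ((ζ : ArithmeticFunction ℝ)) d := by
  rcases Nat.eq_zero_or_pos d with rfl | hd
  · simp
  rw [ArithmeticFunction.natCoe_apply, ArithmeticFunction.zeta_apply_ne hd.ne', Nat.cast_one, mul_one]
  unfold factorErr
  refine sum_abs_boxRestrict_dep_le (by linarith) hΔ.le K _ (by split_ifs <;> linarith) d fun k hk => ?_
  have h := abs_factorErr_le (z := z) (U := U) hx hΔ hΔ1 hij k d
  unfold factorErr at h
  rwa [boxRestrict_apply, if_pos hk] at h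

/-- `(ζ^{⋆m})(n) ≤ τ(n)^m` for the Dirichlet power of `1` over `Fin m` (and it is `≥ 0`). [folklore] -/
theorem prod_zeta_apply_le (m n : ℕ) :
    (∏ _i : Fin m, (ζ : ArithmeticFunction ℝ)) n ≤ (σ 0 n : ℝ) ^ m := by
  have h := abs_prod_apply_le_sigma_zero_pow (Finset.univ : Finset (Fin m))
    (fun _ => (ζ : ArithmeticFunction ℝ)) (fun _ _ d => abs_zeta_le_one d) n
  rw [Finset.card_univ, Fintype.card_fin] at h
  exact le_trans (le_abs_self _) h

/-- **Pointwise bound for the error products summed over all tuples**: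
`∑_κ |PErr κ (n)| ≤ Δ τ(n)^{2j}`. [cite: BombieriFriedlanderIwaniecActa1986, §15 p. 245–246] -/
theorem sum_abs_prodErr_le (hj : 1 ≤ j) (hx : 0 < x) (hΔ : 0 < Δ) (hΔ1 : Δ ≤ 1) (n : ℕ) :
    ∑ κ ∈ tuples j K, |prodErr x z Δ U j κ n| ≤ Δ * (σ 0 n : ℝ) ^ (2 * j) := by
  unfold tuples prodErr
  refine (sum_abs_prod_apply_le (Finset.range K)
    (fun (i : Fin (2 * j)) (k : ℕ) => factorErr x z Δ U j i.val k) n).trans ?_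
  -- compare with `∏_i b_i`, `b_i = (Δ or 1) · ζ`
  set b : Fin (2 * j) → ArithmeticFunction ℝ :=
    fun i => (if (i : ℕ) = 2 * j - 1 then Δ else 1) • (ζ : ArithmeticFunction ℝ) with hb
  have hle : (∏ i : Fin (2 * j), ∑ k ∈ Finset.range K, absAF (factorErr x z Δ U j i.val k)) n ≤
      (∏ i : Fin (2 * j), b i) n := by
    refine prod_apply_le_prod_apply (Finset.univ : Finset (Fin (2 * j))) (fun i _ d => ?_) (fun i _ d => ?_) n
    · rw [HeathBrown.finset_sum_apply]; exact Finset.sum_nonneg fun _ _ => abs_nonneg _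
    · rw [HeathBrown.finset_sum_apply]
      simp only [absAF_apply, hb, ArithmeticFunction.smul_map, smul_eq_mul]
      exact sum_abs_factorErr_le hx hΔ hΔ1 i.isLt K d
  refine hle.trans ?_
  -- `∏ b_i = Δ · ζ^{2j}`
  have hprod : ∏ i : Fin (2 * j), b i = Δ • (∏ _i : Fin (2 * j), (ζ : ArithmeticFunction ℝ)) := by
    have h2j : 0 < 2 * j := by omega
    set i₀ : Fin (2 * j) := ⟨2 * j - 1, by omega⟩
    rw [← Finset.mul_prod_erase _ _ (Finset.mem_univ i₀),
      ← Finset.mul_prod_erase _ (fun _ => (ζ : ArithmeticFunction ℝ)) (Finset.mem_univ i₀)]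
    have hrest : ∏ i ∈ Finset.univ.erase i₀, b i = ∏ i ∈ Finset.univ.erase i₀, (ζ : ArithmeticFunction ℝ) := by
      refine Finset.prod_congr rfl fun i hi => ?_
      have : (i : ℕ) ≠ 2 * j - 1 := by
        intro h; apply Finset.ne_of_mem_erase hi; ext; exact h
      simp only [hb, if_neg this]
      ext n; simp
    rw [hrest]
    have hi₀ : ((i₀ : Fin (2 * j)) : ℕ) = 2 * j - 1 := rfl
    simp only [hb, hi₀, if_true, smul_mul_assoc]
  rw [hprod, ArithmeticFunction.smul_map, smul_eq_mul]
  exact mul_le_mul_of_nonneg_left (prod_zeta_apply_le _ _) hΔ.le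

/-- **Pointwise bound for the main products summed over all tuples**: `∑_κ |PMain κ (n)| ≤ τ(n)^{2j}`.
[cite: BombieriFriedlanderIwaniecActa1986, §15 p. 245–246] -/
theorem sum_abs_prodMain_le (hx : 0 < x) (hΔ : 0 ≤ Δ) (n : ℕ) :
    ∑ κ ∈ tuples j K, |prodMain x z Δ U j κ n| ≤ (σ 0 n : ℝ) ^ (2 * j) := by
  unfold tuples prodMain
  refine (sum_abs_prod_apply_le (Finset.range K)
    (fun (i : Fin (2 * j)) (k : ℕ) => factorMain x z Δ U j i.val k) n).trans ?_
  have hle : (∏ i : Fin (2 * j), ∑ k ∈ Finset.range K, absAF (factorMain x z Δ U j i.val k)) n ≤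
      (∏ _i : Fin (2 * j), (ζ : ArithmeticFunction ℝ)) n := by
    refine prod_apply_le_prod_apply (Finset.univ : Finset (Fin (2 * j))) (fun i _ d => ?_) (fun i _ d => ?_) n
    · rw [HeathBrown.finset_sum_apply]; exact Finset.sum_nonneg fun _ _ => abs_nonneg _
    · rw [HeathBrown.finset_sum_apply]
      simp only [absAF_apply]
      exact sum_abs_factorMain_le hx hΔ i.isLt K d
  exact hle.trans (prod_zeta_apply_le _ _)

end Main

/-! ### Supports of the main products -/

section Support

variable {x z Δ : ℝ} {U j K : ℕ}

/-- The support of a main factor: the box, and `z`-rough. [folklore] -/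
theorem factorMain_ne_zero {i k d : ℕ} (h : factorMain x z Δ U j i k d ≠ 0) :
    InBox (2 * x) Δ k d ∧ IsRough z d := by
  unfold factorMain at h
  obtain ⟨hin, h2⟩ := boxRestrict_ne_zero h
  exact ⟨hin, isRough_of_roughRestrict_ne_zero h2⟩

/-- `tupleHigh κ = (1+Δ)^{2j} tupleLow κ` (`Δ > −1`). [folklore] -/
theorem tupleHigh_eq (hΔ : -1 < Δ) (κ : Fin (2 * j) → ℕ) :
    tupleHigh x Δ j κ = (1 + Δ) ^ (2 * j) * tupleLow x Δ j κ := by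
  unfold tupleHigh tupleLow
  rw [Finset.prod_congr rfl fun i _ => boxHigh_eq_mul_boxLow hΔ (κ i), Finset.prod_mul_distrib,
    Finset.prod_const, Finset.card_univ, Fintype.card_fin]

/-- `0 < tupleLow κ` (`x > 0`, `Δ > −1`). [folklore] -/
theorem tupleLow_pos (hx : 0 < x) (hΔ : -1 < Δ) (κ : Fin (2 * j) → ℕ) : 0 < tupleLow x Δ j κ :=
  Finset.prod_pos fun i _ => boxLow_pos (by linarith) hΔ (κ i)

/-- The support of a sub-product of main factors over a nonempty set `S` of slots: inside
`(∏_{i∈S} boxLow (κ i), ∏_{i∈S} boxHigh (κ i)]`, and `z`-rough. [folklore] -/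
theorem prod_factorMain_ne_zero (hx : 0 < x) (hΔ : -1 < Δ) {S : Finset (Fin (2 * j))} (hS : S.Nonempty)
    (κ : Fin (2 * j) → ℕ) {n : ℕ} (hn : (∏ i ∈ S, factorMain x z Δ U j i (κ i)) n ≠ 0) :
    (∏ i ∈ S, boxLow (2 * x) Δ (κ i)) < n ∧ (n : ℝ) ≤ ∏ i ∈ S, boxHigh (2 * x) Δ (κ i) ∧ IsRough z n := by
  have hb := prod_apply_ne_zero_bounds hS (f := fun i => factorMain x z Δ U j i (κ i))
    (a := fun i => boxLow (2 * x) Δ (κ i)) (b := fun i => boxHigh (2 * x) Δ (κ i))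
    (fun i _ => (boxLow_pos (by linarith) hΔ (κ i)).le)
    (fun i _ d hd => ⟨(factorMain_ne_zero hd).1.2.1, (factorMain_ne_zero hd).1.2.2⟩) hn
  exact ⟨hb.1, hb.2, isRough_of_prod_apply_ne_zero S (fun i _ d hd => (factorMain_ne_zero hd).2) hn⟩

/-- The support of `PMain κ`: `(tupleLow κ, tupleHigh κ]`, `z`-rough (`j ≥ 1`). [folklore] -/
theorem prodMain_ne_zero (hj : 1 ≤ j) (hx : 0 < x) (hΔ : -1 < Δ) (κ : Fin (2 * j) → ℕ) {n : ℕ}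
    (hn : prodMain x z Δ U j κ n ≠ 0) :
    tupleLow x Δ j κ < n ∧ (n : ℝ) ≤ tupleHigh x Δ j κ ∧ IsRough z n := by
  have huniv : (Finset.univ : Finset (Fin (2 * j))).Nonempty :=
    ⟨⟨0, by omega⟩, Finset.mem_univ _⟩
  exact prod_factorMain_ne_zero hx hΔ huniv κ hn

/-- **Non-interior tuples only see the slivers**: if `κ` is not interior and `PMain κ (n) ≠ 0`, then
`n ≤ x(1+Δ)^{2j}` or `2x/(1+Δ)^{2j} < n`. [cite: BombieriFriedlanderIwaniecActa1986, §15 p. 245–246] -/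
theorem mem_slivers_of_not_interior (hj : 1 ≤ j) (hx : 0 < x) (hΔ : 0 ≤ Δ) {κ : Fin (2 * j) → ℕ}
    (hκ : ¬ Interior x Δ j κ) {n : ℕ} (hn : prodMain x z Δ U j κ n ≠ 0) :
    (n : ℝ) ≤ x * (1 + Δ) ^ (2 * j) ∨ 2 * x / (1 + Δ) ^ (2 * j) < n := by
  have hΔ' : -1 < Δ := by linarith
  obtain ⟨hlo, hhi, -⟩ := prodMain_ne_zero hj hx hΔ' κ hn
  rw [tupleHigh_eq hΔ'] at hhi
  have hpow : 0 < (1 + Δ) ^ (2 * j) := by positivity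
  unfold Interior at hκ
  rw [not_and_or, not_le, not_le, tupleHigh_eq hΔ'] at hκ
  rcases hκ with h1 | h2
  · left
    calc (n : ℝ) ≤ (1 + Δ) ^ (2 * j) * tupleLow x Δ j κ := hhi
      _ ≤ (1 + Δ) ^ (2 * j) * x := mul_le_mul_of_nonneg_left h1.le hpow.le
      _ = x * (1 + Δ) ^ (2 * j) := mul_comm _ _
  · right
    rw [div_lt_iff₀ hpow]
    calc 2 * x < (1 + Δ) ^ (2 * j) * tupleLow x Δ j κ := h2
      _ < (1 + Δ) ^ (2 * j) * n := mul_lt_mul_of_pos_left hlo hpow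
      _ = (n : ℝ) * (1 + Δ) ^ (2 * j) := mul_comm _ _

/-- `(1+Δ)^m ≤ 2` for `0 ≤ Δ`, `m Δ ≤ 1/2` (`(1+Δ)^m ≤ exp(mΔ) ≤ 1 + 2 mΔ`). [folklore] -/
theorem one_add_pow_le_two {Δ' : ℝ} (hΔ : 0 ≤ Δ') {m : ℕ} (hm : (m : ℝ) * Δ' ≤ 1 / 2) : (1 + Δ') ^ m ≤ 2 := by
  have h1 : (1 + Δ') ^ m ≤ Real.exp ((m : ℝ) * Δ') := by
    calc (1 + Δ') ^ m ≤ (Real.exp Δ') ^ m := pow_le_pow_left₀ (by linarith) (by linarith [Real.add_one_le_exp Δ']) m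
      _ = Real.exp ((m : ℝ) * Δ') := by rw [← Real.exp_nat_mul]
  have h2 : Real.exp ((m : ℝ) * Δ') ≤ 1 + 2 * ((m : ℝ) * Δ') := by
    have h0 : 0 ≤ (m : ℝ) * Δ' := by positivity
    have := Real.abs_exp_sub_one_sub_id_le (x := (m : ℝ) * Δ') (by rw [abs_of_nonneg h0]; linarith)
    have h3 := (abs_le.1 this).2
    nlinarith
  linarith

/-- **Grouping an interior tuple**: for interior `κ` and a set of slots `S` with `S` and `Sᶜ` nonempty,
put `α = ∏_{i∉S} factorMain`, `β = ∏_{i∈S} factorMain`, `M = ∏_{i∉S} boxLow`, `N = ∏_{i∈S} boxLow`.  If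
`(1+Δ)^{2j} ≤ 2` then `α` is supported in `m ∼ M` (and `z`-rough), `β` in `n ∼ N` (and `z`-rough),
`M N = tupleLow κ`, and the supports multiply into `(x, 2x]`: `α(m) β(n) ≠ 0 ⇒ x < mn ≤ 2x`.
[cite: BombieriFriedlanderIwaniecActa1986, §15 p. 245–246] -/
theorem interior_grouping (hx : 0 < x) (hΔ : 0 ≤ Δ) (hΔj : (1 + Δ) ^ (2 * j) ≤ 2)
    {κ : Fin (2 * j) → ℕ} (hκ : Interior x Δ j κ) {S : Finset (Fin (2 * j))} (hS : S.Nonempty)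
    (hSc : Sᶜ.Nonempty) :
    (∀ m : ℕ, (∏ i ∈ Sᶜ, factorMain x z Δ U j i (κ i)) m ≠ 0 →
        m ∈ dyadic (∏ i ∈ Sᶜ, boxLow (2 * x) Δ (κ i)) ∧ IsRough z m) ∧
    (∀ n : ℕ, (∏ i ∈ S, factorMain x z Δ U j i (κ i)) n ≠ 0 →
        n ∈ dyadic (∏ i ∈ S, boxLow (2 * x) Δ (κ i)) ∧ IsRough z n) ∧
    (∏ i ∈ Sᶜ, boxLow (2 * x) Δ (κ i)) * (∏ i ∈ S, boxLow (2 * x) Δ (κ i)) = tupleLow x Δ j κ ∧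
    (∀ m n : ℕ, (∏ i ∈ Sᶜ, factorMain x z Δ U j i (κ i)) m ≠ 0 →
        (∏ i ∈ S, factorMain x z Δ U j i (κ i)) n ≠ 0 → x < (m : ℝ) * n ∧ (m : ℝ) * n ≤ 2 * x) := by
  have hΔ' : -1 < Δ := by linarith
  have h1Δ : 1 ≤ 1 + Δ := by linarith
  have hpowle : ∀ T : Finset (Fin (2 * j)), (1 + Δ) ^ T.card ≤ 2 := fun T =>
    le_trans (pow_le_pow_right₀ h1Δ (by
      calc T.card ≤ (Finset.univ : Finset (Fin (2 * j))).card := Finset.card_le_card (Finset.subset_univ T)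
        _ = 2 * j := by rw [Finset.card_univ, Fintype.card_fin])) hΔj
  have hhigh : ∀ T : Finset (Fin (2 * j)), ∏ i ∈ T, boxHigh (2 * x) Δ (κ i) =
      (1 + Δ) ^ T.card * ∏ i ∈ T, boxLow (2 * x) Δ (κ i) := by
    intro T
    rw [Finset.prod_congr rfl fun i _ => boxHigh_eq_mul_boxLow hΔ' (κ i), Finset.prod_mul_distrib,
      Finset.prod_const]
  have hTpos : ∀ T : Finset (Fin (2 * j)), 0 < ∏ i ∈ T, boxLow (2 * x) Δ (κ i) := fun T =>
    Finset.prod_pos fun i _ => boxLow_pos (by linarith) hΔ' (κ i)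
  have hsupp : ∀ T : Finset (Fin (2 * j)), T.Nonempty → ∀ m : ℕ,
      (∏ i ∈ T, factorMain x z Δ U j i (κ i)) m ≠ 0 →
        (∏ i ∈ T, boxLow (2 * x) Δ (κ i)) < m ∧ (m : ℝ) ≤ (1 + Δ) ^ T.card * ∏ i ∈ T, boxLow (2 * x) Δ (κ i) ∧
          IsRough z m := by
    intro T hT m hm
    obtain ⟨h1, h2, h3⟩ := prod_factorMain_ne_zero hx hΔ' hT κ hm
    rw [hhigh T] at h2
    exact ⟨h1, h2, h3⟩
  have hdy : ∀ T : Finset (Fin (2 * j)), T.Nonempty → ∀ m : ℕ,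
      (∏ i ∈ T, factorMain x z Δ U j i (κ i)) m ≠ 0 →
        m ∈ dyadic (∏ i ∈ T, boxLow (2 * x) Δ (κ i)) ∧ IsRough z m := by
    intro T hT m hm
    obtain ⟨h1, h2, h3⟩ := hsupp T hT m hm
    refine ⟨(mem_dyadic (hTpos T).le).2 ⟨h1, h2.trans ?_⟩, h3⟩
    exact mul_le_mul_of_nonneg_right (hpowle T) (hTpos T).le
  have hMN : (∏ i ∈ Sᶜ, boxLow (2 * x) Δ (κ i)) * (∏ i ∈ S, boxLow (2 * x) Δ (κ i)) = tupleLow x Δ j κ := by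
    unfold tupleLow
    exact (mul_comm _ _).trans (Finset.prod_mul_prod_compl S _)
  refine ⟨hdy Sᶜ hSc, hdy S hS, hMN, fun m n hm hn => ?_⟩
  obtain ⟨hm1, hm2, -⟩ := hsupp Sᶜ hSc m hm
  obtain ⟨hn1, hn2, -⟩ := hsupp S hS n hn
  have hcard : Sᶜ.card + S.card = 2 * j := by
    rw [Finset.card_compl, Fintype.card_fin]
    have := Finset.card_le_card (Finset.subset_univ S)
    rw [Finset.card_univ, Fintype.card_fin] at this
    omega
  obtain ⟨hκ1, hκ2⟩ := hκ
  rw [tupleHigh_eq hΔ'] at hκ2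
  constructor
  · calc x ≤ tupleLow x Δ j κ := hκ1
      _ = (∏ i ∈ Sᶜ, boxLow (2 * x) Δ (κ i)) * (∏ i ∈ S, boxLow (2 * x) Δ (κ i)) := hMN.symm
      _ < (m : ℝ) * n := mul_lt_mul'' hm1 hn1 (hTpos _).le (hTpos _).le
  · have hpow2j : (1 + Δ) ^ (2 * j) = (1 + Δ) ^ Sᶜ.card * (1 + Δ) ^ S.card := by
      rw [← pow_add, hcard]
    calc (m : ℝ) * n ≤ ((1 + Δ) ^ Sᶜ.card * ∏ i ∈ Sᶜ, boxLow (2 * x) Δ (κ i)) *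
          ((1 + Δ) ^ S.card * ∏ i ∈ S, boxLow (2 * x) Δ (κ i)) :=
          mul_le_mul hm2 hn2 (Nat.cast_nonneg _) (mul_nonneg (pow_nonneg (by linarith) _) (hTpos _).le)
      _ = (1 + Δ) ^ (2 * j) * tupleLow x Δ j κ := by rw [hpow2j, ← hMN]; ring
      _ ≤ 2 * x := hκ2

/-- `PMain κ = α ⋆ β` for the grouping by `S`. [folklore] -/
theorem prodMain_eq_mul (κ : Fin (2 * j) → ℕ) (S : Finset (Fin (2 * j))) :
    prodMain x z Δ U j κ =
      (∏ i ∈ Sᶜ, factorMain x z Δ U j i (κ i)) * ∏ i ∈ S, factorMain x z Δ U j i (κ i) := by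
  unfold prodMain
  exact ((Finset.prod_mul_prod_compl S _).symm).trans (mul_comm _ _)

end Support

/-! ### Interior pieces are bilinear forms: `sievedDisc (α ⋆ β) = bilinDisc` -/

/-- The filtered sums over `(x, 2x]` of a bilinear form with multiplying supports, as double sums
over the dyadic supports. [folklore] -/
theorem sum_Ioc_ite_mul_eq {α β : ArithmeticFunction ℝ} {M N x z : ℝ} (hx : 0 ≤ x)
    (hM : 0 ≤ M) (hN : 0 ≤ N)
    (hα : ∀ m : ℕ, α m ≠ 0 → m ∈ dyadic M ∧ IsRough z m)
    (hβ : ∀ n : ℕ, β n ≠ 0 → n ∈ dyadic N ∧ IsRough z n)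
    (hprod : ∀ m n : ℕ, α m ≠ 0 → β n ≠ 0 → x < (m : ℝ) * n ∧ (m : ℝ) * n ≤ 2 * x)
    (P : ℕ → Prop) [DecidablePred P] :
    (∑ n ∈ Ioc ⌊x⌋₊ ⌊2 * x⌋₊, if IsRough z n ∧ P n then (α * β) n else 0) =
      ∑ m ∈ dyadic M, ∑ n ∈ dyadic N, if P (m * n) then α m * β n else 0 := by
  set X := ⌊2 * x⌋₊ with hX
  set c : ℕ → ℝ := fun n => if P n then 1 else 0 with hc
  -- the convolution vanishes off `(x, 2x]` and off rough integers
  have hvan : ∀ n : ℕ, (¬ IsRough z n ∨ (n : ℝ) ≤ x) → (α * β) n = 0 := by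
    intro n hn
    rw [ArithmeticFunction.mul_apply]
    refine Finset.sum_eq_zero fun y hy => ?_
    by_contra hne
    have ha : α y.1 ≠ 0 := left_ne_zero_of_mul hne
    have hb : β y.2 ≠ 0 := right_ne_zero_of_mul hne
    have hyn := (Nat.mem_divisorsAntidiagonal.1 hy).1
    rcases hn with hr | hle
    · apply hr; rw [← hyn]; exact (hα _ ha).2.mul (hβ _ hb).2
    · have := (hprod _ _ ha hb).1
      rw [← Nat.cast_mul, hyn] at this
      linarith
  -- Step 1: drop the roughness condition and pass to `c n * (α*β) n` over `[1, X]`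
  have h1 : (∑ n ∈ Ioc ⌊x⌋₊ X, if IsRough z n ∧ P n then (α * β) n else 0) =
      ∑ n ∈ Icc 1 X, c n * (α * β) n := by
    have hsub : Ioc ⌊x⌋₊ X ⊆ Icc 1 X := fun n hn => by
      rw [Finset.mem_Ioc] at hn; rw [Finset.mem_Icc]; omega
    rw [← Finset.sum_subset hsub]
    · refine Finset.sum_congr rfl fun n _ => ?_
      simp only [hc]
      by_cases hP : P n
      · by_cases hr : IsRough z n
        · rw [if_pos ⟨hr, hP⟩, if_pos hP, one_mul]
        · rw [if_neg (fun h => hr h.1), if_pos hP, one_mul, hvan n (Or.inl hr)]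
      · rw [if_neg (fun h => hP h.2), if_neg hP, zero_mul]
    · intro n hn hn'
      rw [Finset.mem_Icc] at hn
      rw [Finset.mem_Ioc, not_and_or] at hn'
      have hnx : (n : ℝ) ≤ x := by
        rcases hn' with h | h
        · rw [not_lt] at h
          exact le_trans (by exact_mod_cast h) (Nat.floor_le hx)
        · omega
      rw [hvan n (Or.inr hnx), mul_zero]
  rw [h1]
  -- Step 2: open the convolution (hyperbola rearrangement)
  have h2 : ∑ n ∈ Icc 1 X, c n * (α * β) n = ∑ d ∈ Icc 1 X, ∑ e ∈ Icc 1 (X / d), c (d * e) * (α d * β e) := by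
    have : ∑ n ∈ Icc 1 X, c n * (α * β) n =
        ∑ n ∈ Icc 1 X, ∑ y ∈ n.divisorsAntidiagonal, c (y.1 * y.2) * (α y.1 * β y.2) := by
      refine Finset.sum_congr rfl fun n _ => ?_
      rw [ArithmeticFunction.mul_apply, Finset.mul_sum]
      refine Finset.sum_congr rfl fun y hy => ?_
      rw [(Nat.mem_divisorsAntidiagonal.1 hy).1]
    rw [this, SquarefreeSums.sum_Icc_sum_divisorsAntidiagonal (fun d e => c (d * e) * (α d * β e)) X]
  rw [h2]
  -- Step 3: restrict both sums to the dyadic supports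
  have hterm : ∀ d e : ℕ, c (d * e) * (α d * β e) = if P (d * e) then α d * β e else 0 := by
    intro d e; simp only [hc]; split_ifs <;> simp
  by_cases hβ0 : ∀ e, β e = 0
  · -- `β = 0`: everything vanishes
    simp [hβ0]
  push Not at hβ0
  obtain ⟨e₀, he₀⟩ := hβ0
  have houter : ∀ d : ℕ, α d ≠ 0 → (d ∈ Icc 1 X ↔ d ∈ dyadic M) := by
    intro d hd
    have hdM := (hα d hd).1
    refine ⟨fun _ => hdM, fun _ => ?_⟩
    have hd1 : 0 < d := pos_of_mem_dyadic hM hdM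
    have hde := (hprod d e₀ hd he₀).2
    have he1 : (1 : ℝ) ≤ e₀ := by exact_mod_cast pos_of_mem_dyadic hN (hβ e₀ he₀).1
    refine Finset.mem_Icc.2 ⟨hd1, Nat.le_floor ?_⟩
    nlinarith [Nat.cast_nonneg (α := ℝ) d]
  calc ∑ d ∈ Icc 1 X, ∑ e ∈ Icc 1 (X / d), c (d * e) * (α d * β e)
      = ∑ d ∈ Icc 1 X, α d * ∑ e ∈ Icc 1 (X / d), c (d * e) * β e := by
        refine Finset.sum_congr rfl fun d _ => ?_
        rw [Finset.mul_sum]; refine Finset.sum_congr rfl fun e _ => ?_; ring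
    _ = ∑ d ∈ dyadic M, α d * ∑ e ∈ Icc 1 (X / d), c (d * e) * β e := by
        refine sum_eq_sum_of_support fun d hd => houter d (left_ne_zero_of_mul hd)
    _ = ∑ d ∈ dyadic M, α d * ∑ e ∈ dyadic N, c (d * e) * β e := by
        refine Finset.sum_congr rfl fun d hd => ?_
        by_cases had : α d = 0
        · rw [had, zero_mul, zero_mul]
        congr 1
        refine sum_eq_sum_of_support fun e he => ?_
        have hbe : β e ≠ 0 := right_ne_zero_of_mul he
        have heN := (hβ e hbe).1
        refine ⟨fun _ => heN, fun _ => ?_⟩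
        have hd1 : 0 < d := pos_of_mem_dyadic hM hd
        refine Finset.mem_Icc.2 ⟨pos_of_mem_dyadic hN heN, ?_⟩
        rw [Nat.le_div_iff_mul_le hd1, mul_comm]
        exact Nat.le_floor (by exact_mod_cast (hprod d e had hbe).2)
    _ = ∑ m ∈ dyadic M, ∑ n ∈ dyadic N, if P (m * n) then α m * β n else 0 := by
        refine Finset.sum_congr rfl fun d _ => ?_
        rw [Finset.mul_sum]
        refine Finset.sum_congr rfl fun e _ => ?_
        rw [← hterm]; ring

/-- **The sieved dyadic discrepancy of a bilinear form with multiplying supports is the bracket of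
BFI (3.1).**  If `α` is supported in `m ∼ M` on `z`-rough integers, `β` in `n ∼ N` on `z`-rough integers,
and `α(m)β(n) ≠ 0 ⇒ x < mn ≤ 2x`, then `sievedDisc (α ⋆ β) q a z x = bilinDisc a M N α β q`.
[cite: BombieriFriedlanderIwaniecActa1986, §15 p. 246 and §3 (3.1) p. 214] -/
theorem sievedDisc_eq_bilinDisc {α β : ArithmeticFunction ℝ} {M N x z : ℝ} (hx : 0 ≤ x)
    (hM : 0 ≤ M) (hN : 0 ≤ N)
    (hα : ∀ m : ℕ, α m ≠ 0 → m ∈ dyadic M ∧ IsRough z m)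
    (hβ : ∀ n : ℕ, β n ≠ 0 → n ∈ dyadic N ∧ IsRough z n)
    (hprod : ∀ m n : ℕ, α m ≠ 0 → β n ≠ 0 → x < (m : ℝ) * n ∧ (m : ℝ) * n ≤ 2 * x)
    (q : ℕ) (a : ℤ) :
    sievedDisc (fun n => (α * β) n) q a z x = bilinDisc a M N α β q := by
  unfold sievedDisc bilinDisc
  rw [sum_Ioc_ite_mul_eq hx hM hN hα hβ hprod (fun n : ℕ => (n : ZMod q) = (a : ZMod q)),
    sum_Ioc_ite_mul_eq hx hM hN hα hβ hprod (fun n : ℕ => n.Coprime q)]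

end BFI

end Literature.NumberTheory.Sieve
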